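import Summits.RiemannHypothesis.RiemannHypothesis.Theses.PluckedString
import Literature.NumberTheory.LFunctions.WeilFirstPrimePositivityC
import HarnessLib

/-!
# Route PluckedString, crux #3 `FirstPluck`: the string survives its first pluck — PROVED

`Summit.RiemannHypothesis.RiemannHypothesis.Theses.PluckedString.FirstPluck`
(`= WeilPositivityOn ((log 3)/2)`) by the kernel-checked Stage-C first-prime certificate
(`Literature.NumberTheory.LFunctions.weilPositivityOn_log_three_half`).
-/

noncomputable section

namespace Summit.RiemannHypothesis.RiemannHypothesis.Theorems

/-- **The first pluck** (route PluckedString crux #3): Weil positivity for tests supported in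
`[−(log 3)/2, (log 3)/2]`. [cite: Yoshida1992, Thm 1 (p. 310), §6 (method); certificate new] -/
theorem FirstPluck_proof : Summit.RiemannHypothesis.RiemannHypothesis.Theses.PluckedString.FirstPluck := by
  unfold Summit.RiemannHypothesis.RiemannHypothesis.Theses.PluckedString.FirstPluck
  exact Literature.NumberTheory.LFunctions.weilPositivityOn_log_three_half

end Summit.RiemannHypothesis.RiemannHypothesis.Theorems
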